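import Literature.Topology.FourManifolds.FlipFrame
import Literature.Topology.FourManifolds.ExitBend
import HarnessLib

/-!
# The flip frame is a clear wall frame and a neck frame

Topic `Literature/Topology/FourManifolds` (trunk T-4MAN). Fact seat
`provefact-Literature.Topology.FourManifolds.Knot.IsConnectedSum.isIsotopic` (Schubert's theorem),
geometric heart for rail knots. For a flip pair `(b₁, b₂)` at spike/arc scales with a common `κ`
small enough for the **pair scale** (`PairScale`: the blow-up coordinates of `b₁` at a reflected
point are, up to `1/32`, the blow-up coordinates of `b₂` with the first two negated —
`FlipPair.exists_blowUp_sphereInv_near`), the flip frame `flipBase u` of `FlipFrame.lean` is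

* a **neck frame** of `b₁` (`isNeckFrame_flipBase`): its foreign points are reflected deep-arc
  points, of first `b₁`-blow-up coordinate `≤ 1/16` (`WallSpikes.IsSpikeForeign`);
* after putting the spikes of `b₁` back (`flipSpiked u = spikeFam (flipBase u) 1`,
  `WallSpikes.lean`), a **wall frame** of `b₁` (`isWallFrame_flipSpiked`: the foreign points are of
  kind (W4) — closed northern hemisphere, first blow-up coordinate `< 3/8`) which is **clear for
  the bend** (`isBendClear_flipSpiked`: blow-up distance `≥ 2` from the centre `O`, because the
  reflected arc has `b₂`-first coordinate `≥ 1 - 8ε₂` and second `∓1` or first `≥ 7/2`);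
* the knots of the spiked flip frames for `u ∈ [0, 1]` are isotopic (`isIsotopic_flipKnot`).

Everything is proved; no named facts are introduced.

## References

* M. W. Hirsch, *Differential Topology*, Springer GTM 33 (1976), Ch. 8 §1. [HirschDT1976]
-/

open scoped Manifold ContDiff Topology Real
open Function Set Metric Filter

noncomputable section

namespace Literature.Topology.FourManifolds

/-- Local notation: `𝔼 n` is the model Euclidean space `EuclideanSpace ℝ (Fin n)`. -/
local notation "𝔼 " n:arg => EuclideanSpace ℝ (Fin n)

/-- Local notation: `𝕊 n` is the unit sphere in `EuclideanSpace ℝ (Fin (n + 1))`. -/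
local notation "𝕊 " n:arg => (Metric.sphere (0 : EuclideanSpace ℝ (Fin (n + 1))) 1)

attribute [local instance] fact_finrank_euclideanSpace_succ

open KnotsInBall ExitBend

/-- `ψ⁻¹ 0` is the south pole. [folklore] -/
theorem psiN_symm_zero : psiN.symm (0 : 𝔼 3) = southPole := by
  apply Subtype.ext
  rw [psiN, coe_stereographic'_symm_zero, coe_southPole, coe_northPole]

/-- `ψ` of the south pole is `0`. [folklore] -/
theorem psiN_southPole : psiN (southPole : 𝕊 3) = 0 := by
  rw [← psiN_symm_zero, psiN_apply_psiN_symm]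

/-- **The reflection of `ψ⁻¹ y`, `y ≠ 0`, is not the north pole, and its chart value is the
inversion of `y`.** [folklore] -/
theorem psiN_reflectLast_psiN_symm {y : 𝔼 3} (hy : y ≠ 0) :
    reflectLast 3 (psiN.symm y) ≠ northPole ∧ psiN (reflectLast 3 (psiN.symm y)) = sphereInv y := by
  have hS : reflectLast 3 (psiN.symm y) ≠ northPole := by
    intro h
    have h1 : psiN.symm y = southPole := (reflectLast_eq_northPole_iff _).1 h
    have : y = 0 := by rw [← psiN_apply_psiN_symm y, h1, psiN_southPole]
    exact hy this
  exact ⟨hS, by rw [psiN_reflectLast (psiN_symm_ne_northPole y) hS, psiN_apply_psiN_symm]⟩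

/-- The norm of a vector of `ℝ³` dominates the planar norm of its first two coordinates.
[folklore] -/
theorem sq_add_sq_le_norm_sq (W : 𝔼 3) : W 0 ^ 2 + W 1 ^ 2 ≤ ‖W‖ ^ 2 := by
  rw [EuclideanSpace.norm_eq, Real.sq_sqrt (Finset.sum_nonneg fun i _ ↦ sq_nonneg _), Fin.sum_univ_three]
  simp only [Real.norm_eq_abs, sq_abs]
  nlinarith [sq_nonneg (W 2)]

namespace BandData

section Flip

variable {A₁ B₁ K₁ : Knot} {b₁ : BandData A₁ B₁ K₁ ∅} {A₂ B₂ K₂ : Knot} {b₂ : BandData A₂ B₂ K₂ ∅}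
  {hcross₁ : b₁.band ⁻¹' sphereEquator 2 ∩ squareNhd b₁.δ = {x ∈ squareNhd b₁.δ | x 0 = 2⁻¹}}
  {hcross₂ : b₂.band ⁻¹' sphereEquator 2 ∩ squareNhd b₂.δ = {x ∈ squareNhd b₂.δ | x 0 = 2⁻¹}}

/-! ### Pair scales -/

/-- **Pair scales**: `κ` is so small that the `b₁`-blow-up coordinates of the inversion of
`blowDown₂ Z`, `‖Z‖ ≤ 10`, are within `1/32` of `(-Z₀, -Z₁, μ Z₂)`. [folklore] -/
structure PairScale (hP : IsFlipPair b₁ b₂)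
    (hcross₂ : b₂.band ⁻¹' sphereEquator 2 ∩ squareNhd b₂.δ = {x ∈ squareNhd b₂.δ | x 0 = 2⁻¹})
    (hcross₁ : b₁.band ⁻¹' sphereEquator 2 ∩ squareNhd b₁.δ = {x ∈ squareNhd b₁.δ | x 0 = 2⁻¹}) (κ : ℝ) : Prop where
  near : ∀ Z : 𝔼 3, ‖Z‖ ≤ 10 →
    ‖b₁.blowUp hcross₁ κ (sphereInv (b₂.blowDown hcross₂ κ Z)) - pt3 (-Z 0) (-Z 1) (hP.mu hcross₂ hcross₁ * Z 2)‖ ≤ 1 / 32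

/-- **Pair scales exist**: every small enough `κ`. [folklore] -/
theorem exists_pairScale (hP : IsFlipPair b₁ b₂) : ∃ κ₁ > 0, ∀ κ, 0 < κ → κ ≤ κ₁ → PairScale hP hcross₂ hcross₁ κ := by
  obtain ⟨κ₁, hκ₁, h⟩ := hP.exists_blowUp_sphereInv_near hcross₂ hcross₁ (Zmax := 10) (ε := 1 / 32) (by norm_num) (by norm_num)
  exact ⟨κ₁, hκ₁, fun κ hκ hκle ↦ ⟨fun Z hZ ↦ h κ hκ hκle Z hZ⟩⟩

variable {σ₁ ε₁ r₁ A₁' κ ε₂ r₂ : ℝ} (h₁ : b₁.SpikeScale hcross₁ σ₁ ε₁ r₁ A₁' κ) (h₂ : b₂.ArcScale hcross₂ ε₂ r₂ κ)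
  {hP : IsFlipPair b₁ b₂} (hT : PairScale hP hcross₂ hcross₁ κ)

/-! ### The reflected arc read in the chart of `b₁` -/

include h₂ in
/-- **A deep-arc chart value is nonzero** (it is within `9κ ‖frame‖ ≤ 1` of `pZero`, `‖pZero‖ = 2`).
[folklore] -/
theorem arcChart_ne_zero {u : ℝ} (hu : u ∈ Icc (0 : ℝ) 1) {τ : ℝ}
    (hτ : τ ∈ Icc (b₂.parLo h₂.κ_pos h₂.seven_le_gapLo neg_seven_mem) (b₂.parHi h₂.κ_pos h₂.seven_le_gapHi neg_seven_mem)) :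
    b₂.arcChart h₂.κ_pos h₂.seven_le_gapLo h₂.seven_le_gapHi u τ ≠ 0 := by
  intro h0
  have h1 := b₂.norm_arcChart_sub_pZero_le h₂.κ_pos h₂.seven_le_gapLo h₂.seven_le_gapHi h₂.flat h₂.nine_lt_r h₂.eps_le_8 hu hτ
  rw [h0, zero_sub, norm_neg, b₂.norm_pZero hcross₂] at h1
  linarith [h₂.frame_small]

include h₂ in
/-- **The reflected arc point in the chart of `b₁`**: not the north pole, chart value
`sphereInv (arcChart₂ u τ)`. [folklore] -/
theorem foreign_chart {u : ℝ} (hu : u ∈ Icc (0 : ℝ) 1) {τ : ℝ}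
    (hτ : τ ∈ Icc (b₂.parLo h₂.κ_pos h₂.seven_le_gapLo neg_seven_mem) (b₂.parHi h₂.κ_pos h₂.seven_le_gapHi neg_seven_mem)) :
    reflectLast 3 (psiN.symm (b₂.arcChart h₂.κ_pos h₂.seven_le_gapLo h₂.seven_le_gapHi u τ)) ≠ northPole ∧
      psiN (reflectLast 3 (psiN.symm (b₂.arcChart h₂.κ_pos h₂.seven_le_gapLo h₂.seven_le_gapHi u τ))) =
        sphereInv (b₂.arcChart h₂.κ_pos h₂.seven_le_gapLo h₂.seven_le_gapHi u τ) :=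
  psiN_reflectLast_psiN_symm (arcChart_ne_zero h₂ hu hτ)

include h₂ hT in
/-- **The `b₁`-blow-up coordinates of the inverted arc are, up to `1/32`, `(-Z₀, -Z₁, μ Z₂)`** with
`Z` the `b₂`-blow-up coordinates of the arc point (`u ∈ [0, 1]`, arc zone). [folklore] -/
theorem norm_blowUp_sphereInv_arcChart_sub_le {u : ℝ} (hu : u ∈ Icc (0 : ℝ) 1) {τ : ℝ}
    (hτ : τ ∈ Icc (b₂.parLo h₂.κ_pos h₂.seven_le_gapLo neg_seven_mem) (b₂.parHi h₂.κ_pos h₂.seven_le_gapHi neg_seven_mem)) :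
    ‖b₁.blowUp hcross₁ κ (sphereInv (b₂.arcChart h₂.κ_pos h₂.seven_le_gapLo h₂.seven_le_gapHi u τ)) -
        pt3 (-b₂.blowUp hcross₂ κ (b₂.arcChart h₂.κ_pos h₂.seven_le_gapLo h₂.seven_le_gapHi u τ) 0)
          (-b₂.blowUp hcross₂ κ (b₂.arcChart h₂.κ_pos h₂.seven_le_gapLo h₂.seven_le_gapHi u τ) 1)
          (hP.mu hcross₂ hcross₁ * b₂.blowUp hcross₂ κ (b₂.arcChart h₂.κ_pos h₂.seven_le_gapLo h₂.seven_le_gapHi u τ) 2)‖ ≤ 1 / 32 := by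
  set Z := b₂.blowUp hcross₂ κ (b₂.arcChart h₂.κ_pos h₂.seven_le_gapLo h₂.seven_le_gapHi u τ)
  have hZ : ‖Z‖ ≤ 10 := by
    have := b₂.norm_blowUp_arcChart_le h₂.κ_pos h₂.seven_le_gapLo h₂.seven_le_gapHi h₂.flat h₂.nine_lt_r hu hτ
    linarith [h₂.eps_le]
  have e : b₂.arcChart h₂.κ_pos h₂.seven_le_gapLo h₂.seven_le_gapHi u τ = b₂.blowDown hcross₂ κ Z :=
    (b₂.blowDown_blowUp hcross₂ h₂.κ_pos.ne' _).symm
  rw [e]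
  exact hT.near Z hZ

include h₂ hT in
/-- **First `b₁`-blow-up coordinate of the inverted arc**: `≤ -Z₀ + 1/32`. [folklore] -/
theorem blowUp_sphereInv_arcChart_zero_le {u : ℝ} (hu : u ∈ Icc (0 : ℝ) 1) {τ : ℝ}
    (hτ : τ ∈ Icc (b₂.parLo h₂.κ_pos h₂.seven_le_gapLo neg_seven_mem) (b₂.parHi h₂.κ_pos h₂.seven_le_gapHi neg_seven_mem)) :
    b₁.blowUp hcross₁ κ (sphereInv (b₂.arcChart h₂.κ_pos h₂.seven_le_gapLo h₂.seven_le_gapHi u τ)) 0 ≤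
      -b₂.blowUp hcross₂ κ (b₂.arcChart h₂.κ_pos h₂.seven_le_gapLo h₂.seven_le_gapHi u τ) 0 + 1 / 32 := by
  have h := norm_blowUp_sphereInv_arcChart_sub_le h₂ hT hu hτ
  have hc := PiLp.norm_apply_le (b₁.blowUp hcross₁ κ (sphereInv (b₂.arcChart h₂.κ_pos h₂.seven_le_gapLo h₂.seven_le_gapHi u τ)) -
    pt3 (-b₂.blowUp hcross₂ κ (b₂.arcChart h₂.κ_pos h₂.seven_le_gapLo h₂.seven_le_gapHi u τ) 0)
      (-b₂.blowUp hcross₂ κ (b₂.arcChart h₂.κ_pos h₂.seven_le_gapLo h₂.seven_le_gapHi u τ) 1)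
      (hP.mu hcross₂ hcross₁ * b₂.blowUp hcross₂ κ (b₂.arcChart h₂.κ_pos h₂.seven_le_gapLo h₂.seven_le_gapHi u τ) 2)) 0
  rw [Real.norm_eq_abs, sub_pt3_apply_zero] at hc
  linarith [(abs_le.1 (hc.trans h)).2]

include h₂ hT in
/-- **On the `Θ`-range the first `b₁`-blow-up coordinate of the inverted arc is `≤ 1/16`**
(`τ ∈ [parLo₂ (1/2), parHi₂ (1/2)]`). [folklore] -/
theorem blowUp_sphereInv_arcChart_zero_le_sixteenth {u : ℝ} (hu : u ∈ Icc (0 : ℝ) 1) {τ : ℝ}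
    (hτ : τ ∈ Icc (b₂.parLo h₂.κ_pos h₂.seven_le_gapLo half_mem) (b₂.parHi h₂.κ_pos h₂.seven_le_gapHi half_mem)) :
    b₁.blowUp hcross₁ κ (sphereInv (b₂.arcChart h₂.κ_pos h₂.seven_le_gapLo h₂.seven_le_gapHi u τ)) 0 ≤ 1 / 16 := by
  have hκ := h₂.κ_pos
  have hτ' : τ ∈ Icc (b₂.parLo hκ h₂.seven_le_gapLo neg_seven_mem) (b₂.parHi hκ h₂.seven_le_gapHi neg_seven_mem) :=
    ⟨(b₂.parLo_le_parLo hκ h₂.seven_le_gapLo neg_seven_mem half_mem (by norm_num)).trans hτ.1,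
      hτ.2.trans (b₂.parHi_le_parHi hκ h₂.seven_le_gapHi neg_seven_mem half_mem (by norm_num))⟩
  have h1 := blowUp_sphereInv_arcChart_zero_le h₂ hT hu hτ'
  have h2 := b₂.blowUp_arcChart_zero_ge hκ h₂.seven_le_gapLo h₂.seven_le_gapHi h₂.flat h₂.nine_lt_r (v := 1 / 2)
    ⟨by norm_num, by norm_num⟩ hu hτ
  linarith [h₂.eps_le]

include h₂ hT in
/-- **On the foreign zone proper the inverted arc is bend-clear**: for `τ ∈ [parLo₂ 1, parHi₂ 1]`
the `b₁`-blow-up coordinates of the inverted arc are at distance `≥ 2` from `O = (1, 0, σ)` (any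
`σ`). [folklore] -/
theorem two_le_norm_blowUp_sphereInv_arcChart_sub_cO (σ : ℝ) {u : ℝ} (hu : u ∈ Icc (0 : ℝ) 1) {τ : ℝ}
    (hτ : τ ∈ Icc (b₂.parLo h₂.κ_pos h₂.seven_le_gapLo (v := 1) ⟨by norm_num, by norm_num⟩)
      (b₂.parHi h₂.κ_pos h₂.seven_le_gapHi (v := 1) ⟨by norm_num, by norm_num⟩)) :
    2 ≤ ‖b₁.blowUp hcross₁ κ (sphereInv (b₂.arcChart h₂.κ_pos h₂.seven_le_gapLo h₂.seven_le_gapHi u τ)) - cO σ‖ := by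
  have hκ := h₂.κ_pos
  have hε := h₂.eps_le
  have hε0 := h₂.flat.eps_nonneg
  have h1m : (1 : ℝ) ∈ Icc (-7 : ℝ) 7 := ⟨by norm_num, by norm_num⟩
  have hτ' : τ ∈ Icc (b₂.parLo hκ h₂.seven_le_gapLo neg_seven_mem) (b₂.parHi hκ h₂.seven_le_gapHi neg_seven_mem) :=
    ⟨(b₂.parLo_le_parLo hκ h₂.seven_le_gapLo neg_seven_mem h1m (by norm_num)).trans hτ.1,
      hτ.2.trans (b₂.parHi_le_parHi hκ h₂.seven_le_gapHi neg_seven_mem h1m (by norm_num))⟩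
  set y := b₂.arcChart hκ h₂.seven_le_gapLo h₂.seven_le_gapHi u τ with hy
  set Z := b₂.blowUp hcross₂ κ y with hZ
  set W := b₁.blowUp hcross₁ κ (sphereInv y) with hW
  have hnear := norm_blowUp_sphereInv_arcChart_sub_le h₂ hT hu hτ'
  rw [← hy, ← hZ, ← hW] at hnear
  -- first coordinate of `Z`
  have hZ0 : 1 - 8 * ε₂ ≤ Z 0 := b₂.blowUp_arcChart_zero_ge hκ h₂.seven_le_gapLo h₂.seven_le_gapHi h₂.flat h₂.nine_lt_r (v := 1)
    ⟨by norm_num, by norm_num⟩ hu hτ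
  -- second coordinate `∓1` or first `≥ 7/2`, up to `8ε₂`
  have hZ1 : 1 - 8 * ε₂ ≤ |Z 1| ∨ 7 / 2 - 8 * ε₂ ≤ Z 0 := by
    rcases le_or_gt τ (b₂.parLo hκ h₂.seven_le_gapLo fifteen_quarters_mem) with h15 | h15
    · left
      have h := b₂.norm_blowUp_arcChart_sub_le_chord hκ h₂.seven_le_gapLo h₂.seven_le_gapHi h₂.flat h₂.nine_lt_r hu ⟨hτ'.1, h15⟩
      rw [← hy, ← hZ] at h
      have hc := PiLp.norm_apply_le (Z - pt3 (turnX (b₂.alphaLo κ τ)) (-1) 0) 1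
      rw [Real.norm_eq_abs, sub_pt3_apply_one] at hc
      have : Z 1 ≤ -1 + 8 * ε₂ := by linarith [(abs_le.1 (hc.trans h)).2]
      rw [abs_of_neg (by linarith)]; linarith
    · have h114 : τ ∈ Icc (b₂.parLo hκ h₂.seven_le_gapLo eleven_quarters_mem) (b₂.parHi hκ h₂.seven_le_gapHi neg_seven_mem) :=
        ⟨(b₂.parLo_le_parLo hκ h₂.seven_le_gapLo eleven_quarters_mem fifteen_quarters_mem (by norm_num)).trans h15.le, hτ'.2⟩
      have h := b₂.norm_blowUp_arcChart_sub_le_band hκ h₂.seven_le_gapLo h₂.seven_le_gapHi h₂.flat h₂.nine_lt_r (u := u) h114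
      rw [← hy, ← hZ] at h
      have hc0 := PiLp.norm_apply_le (Z - pt3 (b₂.deepTrack hκ h₂.seven_le_gapLo h₂.seven_le_gapHi τ 0) (b₂.deepTrack hκ h₂.seven_le_gapLo h₂.seven_le_gapHi τ 1) 0) 0
      have hc1 := PiLp.norm_apply_le (Z - pt3 (b₂.deepTrack hκ h₂.seven_le_gapLo h₂.seven_le_gapHi τ 0) (b₂.deepTrack hκ h₂.seven_le_gapLo h₂.seven_le_gapHi τ 1) 0) 1
      rw [Real.norm_eq_abs, sub_pt3_apply_zero] at hc0
      rw [Real.norm_eq_abs, sub_pt3_apply_one] at hc1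
      have h0 := (abs_le.1 (hc0.trans h)).1
      have h1 := abs_le.1 (hc1.trans h)
      rcases b₂.abs_deepTrack_one_eq_one_or hκ h₂.seven_le_gapLo h₂.seven_le_gapHi τ with hq | hq
      · left
        rcases (abs_eq (by norm_num : (0 : ℝ) ≤ 1)).1 hq with hq1 | hq1
        · rw [hq1] at h1; rw [abs_of_pos (by linarith [h1.1])]; linarith [h1.1]
        · rw [hq1] at h1; rw [abs_of_neg (by linarith [h1.2])]; linarith [h1.2]
      · right; linarith
  -- the model point `ι Z` is far from `O`
  have hfar : (2 + 1 / 32) ^ 2 ≤ (-Z 0 - 1) ^ 2 + (-Z 1 - 0) ^ 2 := by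
    have hε32 : 8 * ε₂ ≤ 1 / 32 := by linarith
    rcases hZ1 with h | h
    · have ha : (63 / 32 : ℝ) ≤ Z 0 + 1 := by linarith
      have hb : (31 / 32 : ℝ) ≤ |Z 1| := by linarith
      nlinarith [sq_abs (Z 1), sq_nonneg (Z 0 + 1 - 63 / 32), sq_nonneg (|Z 1| - 31 / 32)]
    · have ha : (4 : ℝ) ≤ Z 0 + 1 := by linarith
      nlinarith [sq_nonneg (Z 1), sq_nonneg (Z 0 + 1 - 4)]
  -- triangle inequality
  set M : 𝔼 3 := pt3 (-Z 0) (-Z 1) (hP.mu hcross₂ hcross₁ * Z 2) with hM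
  have hMO : 2 + 1 / 32 ≤ ‖M - cO σ‖ := by
    have hsq := sq_add_sq_le_norm_sq (M - cO σ)
    have e0 : (M - cO σ) 0 = -Z 0 - 1 := by simp [hM, cO]
    have e1 : (M - cO σ) 1 = -Z 1 - 0 := by simp [hM, cO]
    rw [e0, e1] at hsq
    nlinarith [norm_nonneg (M - cO σ)]
  have htri : ‖M - cO σ‖ ≤ ‖W - M‖ + ‖W - cO σ‖ := by
    have := norm_sub_le_norm_sub_add_norm_sub M W (cO σ)
    rwa [norm_sub_rev M W] at this
  linarith

/-! ### The flip frame is a neck frame -/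

include h₂ hT in
/-- **Reflected arc points on the `Θ`-range are spike-foreign for `b₁`** (first `b₁`-blow-up
coordinate `≤ 1/16`). [folklore] -/
theorem isSpikeForeign_foreignPt {u : ℝ} (hu : u ∈ Icc (0 : ℝ) 1) (t : ℝ) :
    b₁.IsSpikeForeign hcross₁ κ (foreignPt h₁ h₂ u (theta h₁ h₂ t)) := by
  have hτ := theta_mem h₁ h₂ t
  have hτ' := Ioo_subset_Icc_self (theta_mem_Ioo h₁ h₂ t)
  obtain ⟨hN, hchart⟩ := foreign_chart h₂ hu hτ'
  refine Or.inr ⟨sphereInv (b₂.arcChart h₂.κ_pos h₂.seven_le_gapLo h₂.seven_le_gapHi u (theta h₁ h₂ t)), ?_, Or.inr ?_⟩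
  · rw [foreignPt, ← hchart, psiN_symm_apply_psiN hN]
  · exact blowUp_sphereInv_arcChart_zero_le_sixteenth h₂ hT hu hτ

include hT in
/-- **THE FLIP FRAME IS A NECK FRAME OF `b₁`** (`u ∈ [0, 1]`). [folklore] -/
theorem isNeckFrame_flipBase (hA₁ : A₁.InNorth) (hB₁ : B₁.InSouth) (hAB₁ : Disjoint (range A₁) (range B₁)) (hB₂ : B₂.InSouth)
    {u : ℝ} (hu : u ∈ Icc (0 : ℝ) 1) : b₁.IsNeckFrame hcross₁ κ (flipBase h₁ h₂ u) where
  contDiff := contDiff_flipBase_right h₁ h₂ hP u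
  seam := flipBase_seam h₁ h₂ u
  isRegularLoop := isRegularLoop_flipBase h₁ h₂ hP hu
  injOn := injOn_flipBase h₁ h₂ hP hA₁ hB₁ hAB₁ hB₂ hu
  agree t ht := by
    have hκ := h₁.κ_pos
    refine flipBase_eq_neckPiece h₁ h₂ hP ?_
    rcases ht with ⟨hc, hα⟩ | ⟨hc, hα⟩
    · have h1 : b₁.parLo hκ h₁.seven_le_gapLo neg_seven_halves_mem ≤ t :=
        (b₁.le_alphaLo_iff' hκ h₁.seven_le_gapLo neg_seven_halves_mem hc).1 (by linarith [hα.1])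
      have h2 := (b₁.parHi_mem_core hκ h₁.seven_le_gapHi neg_five_quarters_mem).1
      exact ⟨h1, by linarith [hc.2, b₁.coreLo_lt_coreHi]⟩
    · have h1 : t ≤ b₁.parHi hκ h₁.seven_le_gapHi neg_five_quarters_mem :=
        (b₁.le_alphaHi_iff' hκ h₁.seven_le_gapHi neg_five_quarters_mem hc).1 (by linarith [hα.1])
      have h2 := (b₁.parLo_mem_core hκ h₁.seven_le_gapLo neg_seven_halves_mem).2
      exact ⟨by linarith [hc.1, b₁.coreLo_lt_coreHi], h1⟩
  rest t _ _ := by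
    obtain ⟨m1, m2⟩ := zone_marks h₁
    rcases le_or_gt t (b₁.parLo h₁.κ_pos h₁.seven_le_gapLo neg_seven_halves_mem) with h1 | h1
    · right; rw [flipBase_of_lt h₁ h₂ (lt_of_le_of_lt h1 m1)]; exact isSpikeForeign_foreignPt h₁ h₂ hT hu _
    rcases lt_or_ge t (b₁.parHi h₁.κ_pos h₁.seven_le_gapHi neg_five_quarters_mem) with h2 | h2
    · left; exact flipBase_eq_neckPiece h₁ h₂ hP ⟨h1.le, h2.le⟩
    · right; rw [flipBase_of_gt h₁ h₂ (lt_of_lt_of_le m2 h2)]; exact isSpikeForeign_foreignPt h₁ h₂ hT hu _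

/-! ### The spiked flip frame is a clear wall frame -/

/-- **The spiked flip frame**: the flip frame with the spikes of `b₁` put back (`WallSpikes.spikeFam`
at `u = 1`). [folklore] -/
def flipSpiked (u s : ℝ) : 𝔼 4 := b₁.spikeFam hcross₁ κ σ₁ (flipBase h₁ h₂ u) 1 s

/-- The extended native zone contains the open extended region `{αLo₁ > 1/4, αHi₁ > 1/4}`.
[folklore] -/
theorem mem_zone_of_region {s : ℝ} (hlo : 1 / 4 < b₁.alphaLo κ s) (hhi : 1 / 4 < b₁.alphaHi κ s) :
    s ∈ Icc (b₁.parLo h₁.κ_pos h₁.seven_le_gapLo neg_seven_halves_mem) (b₁.parHi h₁.κ_pos h₁.seven_le_gapHi neg_five_quarters_mem) := by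
  have hκ := h₁.κ_pos
  have hε := b₁.epsLo_bounds.1
  have hε' := b₁.epsHi_bounds.1
  constructor
  · by_contra hlt
    push Not at hlt
    have hc : s ∈ Icc (b₁.tcLo - b₁.epsLo / 8) (b₁.tcLo + b₁.epsLo / 8) ∨ s < b₁.tcLo - b₁.epsLo / 8 := by
      rcases lt_or_ge s (b₁.tcLo - b₁.epsLo / 8) with h | h
      · exact Or.inr h
      · exact Or.inl ⟨h, hlt.le.trans (b₁.parLo_mem_core hκ h₁.seven_le_gapLo neg_seven_halves_mem).2⟩
    rcases hc with hc | hc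
    · have := (b₁.alphaLo_lt_iff' hκ h₁.seven_le_gapLo neg_seven_halves_mem hc).2 hlt; linarith
    · have hmono : b₁.alphaLo κ s ≤ b₁.alphaLo κ (b₁.tcLo - b₁.epsLo / 8) := by
        have h := b₁.monotone_chiLo hc.le
        simp only [alphaLo]; exact div_le_div_of_nonneg_right (by linarith) hκ.le
      linarith [b₁.alphaLo_left_le hκ h₁.seven_le_gapLo]
  · by_contra hlt
    push Not at hlt
    have hc : s ∈ Icc (b₁.tcHi - b₁.epsHi / 8) (b₁.tcHi + b₁.epsHi / 8) ∨ b₁.tcHi + b₁.epsHi / 8 < s := by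
      rcases le_or_gt s (b₁.tcHi + b₁.epsHi / 8) with h | h
      · exact Or.inl ⟨(b₁.parHi_mem_core hκ h₁.seven_le_gapHi neg_five_quarters_mem).1.trans hlt.le, h⟩
      · exact Or.inr h
    rcases hc with hc | hc
    · have := (b₁.alphaHi_lt_iff' hκ h₁.seven_le_gapHi neg_five_quarters_mem hc).2 hlt; linarith
    · have hmono : b₁.alphaHi κ s ≤ b₁.alphaHi κ (b₁.tcHi + b₁.epsHi / 8) := by
        have h := b₁.antitone_chiHi hc.le
        simp only [alphaHi]; exact div_le_div_of_nonneg_right (by linarith) hκ.le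
      linarith [b₁.alphaHi_right_le hκ h₁.seven_le_gapHi]

/-- Off the extended native zone a parameter is off the support of the spikes. [folklore] -/
theorem not_mem_spikeSupp_of_not_mem_zone {t : ℝ}
    (hz : t ∉ Icc (b₁.parLo h₁.κ_pos h₁.seven_le_gapLo neg_seven_halves_mem) (b₁.parHi h₁.κ_pos h₁.seven_le_gapHi neg_five_quarters_mem)) :
    t ∉ b₁.spikeSupp κ := by
  have hκ := h₁.κ_pos
  intro hm
  rcases b₁.spikeSupp_subset_spikeAgree κ hm with ⟨hc, hα⟩ | ⟨hc, hα⟩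
  · refine hz ⟨(b₁.le_alphaLo_iff' hκ h₁.seven_le_gapLo neg_seven_halves_mem hc).1 (by linarith [hα.1]), ?_⟩
    have := (b₁.parHi_mem_core hκ h₁.seven_le_gapHi neg_five_quarters_mem).1
    linarith [hc.2, b₁.coreLo_lt_coreHi]
  · refine hz ⟨?_, (b₁.le_alphaHi_iff' hκ h₁.seven_le_gapHi neg_five_quarters_mem hc).1 (by linarith [hα.1])⟩
    have := (b₁.parLo_mem_core hκ h₁.seven_le_gapLo neg_seven_halves_mem).2
    linarith [hc.1, b₁.coreLo_lt_coreHi]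

variable {ε r A' : ℝ} (HC : b₁.ConeScale hcross₁ ε r A' κ)

/-- **The spiked flip frame at a cone scale.** [folklore] -/
def flipSpikedC (u s : ℝ) : 𝔼 4 := b₁.spikeFam hcross₁ κ b₁.depthSign (flipBase HC.spike h₂ u) 1 s

include hT in
/-- **THE SPIKED FLIP FRAME IS A WALL FRAME OF `b₁`** (cone scale of `b₁`, arc scale of `b₂`, pair
scale, an auxiliary flatness package for the spikes; `A₁` north, `B₁` south, summands disjoint,
`B₂` south; `u ∈ [0, 1]`). [folklore] -/
theorem isWallFrame_flipSpikedC {ε₁' r₁' : ℝ} (hf₁ : b₁.IsFlat hcross₁ ε₁' r₁') (hε₁ : ε₁' ≤ 1 / 100) (hr₁ : 5 * κ < r₁')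
    (hA₁ : A₁.InNorth) (hB₁ : B₁.InSouth) (hAB₁ : Disjoint (range A₁) (range B₁)) (hB₂ : B₂.InSouth)
    {u : ℝ} (hu : u ∈ Icc (0 : ℝ) 1) : b₁.IsWallFrame HC (flipSpikedC h₂ HC u) := by
  have h₁ := HC.spike
  have hF := isNeckFrame_flipBase h₁ h₂ hT hA₁ hB₁ hAB₁ hB₂ hu
  have hκ := h₁.κ_pos
  refine ⟨?_, ?_, ?_, ?_, ?_, ?_⟩
  · exact (b₁.contDiff_spikeFam h₁ hF).comp (contDiff_const.prodMk contDiff_id)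
  · exact seam_of_eqOn_compl hF.seam (b₁.spikeSupp_subset κ) fun t ht ↦ b₁.spikeFam_of_not_mem h₁ _ 1 ht
  · exact b₁.isRegularLoop_spikeFam h₁ hF ⟨zero_le_one, le_rfl⟩
  · exact b₁.injOn_spikeFam h₁ hF hf₁ hε₁ hr₁ ⟨zero_le_one, le_rfl⟩
  · intro s hlo hhi
    exact b₁.spikeFam_of_eq hcross₁ κ b₁.depthSign 1 (flipBase_eq_neckPiece h₁ h₂ hP (mem_zone_of_region h₁ hlo hhi))
  · intro t ht hts
    obtain ⟨m1, m2⟩ := zone_marks h₁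
    by_cases hz : t ∈ Icc (b₁.parLo hκ h₁.seven_le_gapLo neg_seven_halves_mem) (b₁.parHi hκ h₁.seven_le_gapHi neg_five_quarters_mem)
    · -- native: the spiked piece function
      have e : flipSpikedC h₂ HC u t = b₁.spikePiece hcross₁ κ b₁.depthSign 1 t :=
        b₁.spikeFam_of_eq hcross₁ κ b₁.depthSign 1 (flipBase_eq_neckPiece h₁ h₂ hP hz)
      rw [e]; exact b₁.isWallPt_spikePiece_one HC hA₁ ht hts
    · -- foreign: kind (W4)
      have hsupp : t ∉ b₁.spikeSupp κ := not_mem_spikeSupp_of_not_mem_zone h₁ hz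
      have e : flipSpikedC h₂ HC u t = flipBase h₁ h₂ u t := b₁.spikeFam_of_not_mem h₁ _ 1 hsupp
      rw [e]
      -- the foreign formula
      obtain ⟨τ, hτeq, hθ⟩ : ∃ τ, flipBase h₁ h₂ u t = foreignPt h₁ h₂ u (theta h₁ h₂ τ) ∧ True := by
        rcases lt_or_ge t (b₁.parLo hκ h₁.seven_le_gapLo neg_one_mem) with h1 | h1
        · exact ⟨t + 1, flipBase_of_lt h₁ h₂ h1, trivial⟩
        · have h2 : b₁.parHi hκ h₁.seven_le_gapHi neg_one_mem < t := by
            by_contra h2; exact hz ⟨m1.le.trans h1, (not_lt.1 h2).trans m2.le⟩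
          exact ⟨t, flipBase_of_gt h₁ h₂ h2, trivial⟩
      rw [hτeq]
      have hτ := theta_mem h₁ h₂ τ
      have hτ' := Ioo_subset_Icc_self (theta_mem_Ioo h₁ h₂ τ)
      obtain ⟨hm, hm'⟩ := theta_mem_Ioo_centres h₁ h₂ τ
      obtain ⟨hN, hchart⟩ := foreign_chart h₂ hu hτ'
      refine Or.inr (Or.inr (Or.inr ⟨reflectLast 3 (psiN.symm (b₂.arcChart hκ h₂.seven_le_gapLo h₂.seven_le_gapHi u (theta h₁ h₂ τ))),
        rfl, (foreignPt_last_pos h₁ h₂ hB₂ hu hm hm').le, fun _ ↦ ?_⟩))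
      rw [hchart]
      linarith [blowUp_sphereInv_arcChart_zero_le_sixteenth h₂ hT hu hτ]

/-- **Off the extended native zone the flip frame is a reflected arc point of level `≥ 1`**:
`flipBase u t = foreignPt u τ` with `τ ∈ [parLo₂ 1, parHi₂ 1]`, for `t ∈ [alo₁, alo₁ + 1)` outside
`[parLo₁ (-7/2), parHi₁ (-5/4)]`. [folklore] -/
theorem flipBase_eq_foreignPt_of_not_mem_zone {u t : ℝ} (ht : t ∈ Ico b₁.alo (b₁.alo + 1))
    (hz : t ∉ Icc (b₁.parLo h₁.κ_pos h₁.seven_le_gapLo neg_seven_halves_mem) (b₁.parHi h₁.κ_pos h₁.seven_le_gapHi neg_five_quarters_mem)) :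
    ∃ τ ∈ Icc (b₂.parLo h₁.κ_pos h₂.seven_le_gapLo (v := 1) ⟨by norm_num, by norm_num⟩)
        (b₂.parHi h₁.κ_pos h₂.seven_le_gapHi (v := 1) ⟨by norm_num, by norm_num⟩),
      flipBase h₁ h₂ u t = foreignPt h₁ h₂ u τ := by
  have hκ := h₁.κ_pos
  have hcm := b₁.core_marks
  obtain ⟨m1, m2⟩ := zone_marks h₁
  obtain ⟨j1, j2⟩ := jc_junctions h₁ h₂
  have hmono := strictMonoOn_junctionClock b₁ b₂ hκ h₁.seven_le_gapLo h₁.seven_le_gapHi h₂.seven_le_gapLo h₂.seven_le_gapHi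
  have z1 := b₁.parHi_le_parHi hκ h₁.seven_le_gapHi neg_one_mem neg_half_mem (by norm_num)
  have z1' := b₁.parHi_le_parHi hκ h₁.seven_le_gapHi neg_five_quarters_mem neg_three_quarters_mem (by norm_num)
  have z2 := b₁.parLo_le_parLo hκ h₁.seven_le_gapLo neg_one_mem neg_half_mem (by norm_num)
  have z2' := b₁.parLo_le_parLo hκ h₁.seven_le_gapLo neg_seven_halves_mem neg_three_quarters_mem (by norm_num)
  have c1 := (b₁.parHi_mem_core hκ h₁.seven_le_gapHi neg_one_mem).2
  have c2 := (b₁.parLo_mem_core hκ h₁.seven_le_gapLo neg_one_mem).1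
  have c1' := (b₁.parHi_mem_core hκ h₁.seven_le_gapHi neg_three_quarters_mem).2
  have c2' := (b₁.parLo_mem_core hκ h₁.seven_le_gapLo neg_three_quarters_mem).1
  have hmemL : b₁.parHi hκ h₁.seven_le_gapHi neg_one_mem ∈ Icc (b₁.parHi hκ h₁.seven_le_gapHi neg_half_mem) (b₁.parLo hκ h₁.seven_le_gapLo neg_half_mem + 1) :=
    ⟨z1, by linarith⟩
  have hmemR : b₁.parLo hκ h₁.seven_le_gapLo neg_one_mem + 1 ∈ Icc (b₁.parHi hκ h₁.seven_le_gapHi neg_half_mem) (b₁.parLo hκ h₁.seven_le_gapLo neg_half_mem + 1) :=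
    ⟨by linarith, by linarith⟩
  rcases lt_or_ge t (b₁.parLo hκ h₁.seven_le_gapLo neg_seven_halves_mem) with h1 | h1
  · -- early zone, through `t + 1`
    have hτm : t + 1 ∈ Icc (b₁.parHi hκ h₁.seven_le_gapHi neg_half_mem) (b₁.parLo hκ h₁.seven_le_gapLo neg_half_mem + 1) :=
      ⟨by linarith [ht.1], by linarith⟩
    refine ⟨jc h₁ h₂ (t + 1), ⟨?_, ?_⟩, ?_⟩
    · rw [← j1]; exact hmono.monotoneOn hmemL hτm (by linarith [ht.1])
    · rw [← j2]; exact hmono.monotoneOn hτm hmemR (by linarith)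
    · rw [flipBase_of_lt h₁ h₂ (lt_trans h1 m1), theta_eq h₁ h₂ ⟨by linarith [ht.1], by linarith⟩]
  · have h2 : b₁.parHi hκ h₁.seven_le_gapHi neg_five_quarters_mem < t := by
      by_contra h2; exact hz ⟨h1, not_lt.1 h2⟩
    have hτm : t ∈ Icc (b₁.parHi hκ h₁.seven_le_gapHi neg_half_mem) (b₁.parLo hκ h₁.seven_le_gapLo neg_half_mem + 1) :=
      ⟨by linarith, by linarith [ht.2]⟩
    refine ⟨jc h₁ h₂ t, ⟨?_, ?_⟩, ?_⟩
    · rw [← j1]; exact hmono.monotoneOn hmemL hτm (by linarith)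
    · rw [← j2]; exact hmono.monotoneOn hτm hmemR (by linarith [ht.2])
    · rw [flipBase_of_gt h₁ h₂ (lt_trans m2 h2), theta_eq h₁ h₂ ⟨by linarith, by linarith [ht.2]⟩]

include hT in
/-- **THE SPIKED FLIP FRAME IS CLEAR FOR THE BEND** (`u ∈ [0, 1]`). [folklore] -/
theorem isBendClear_flipSpikedC {u : ℝ} (hu : u ∈ Icc (0 : ℝ) 1) : b₁.IsBendClear HC (flipSpikedC h₂ HC u) := by
  have h₁ := HC.spike
  have hκ := h₁.κ_pos
  intro t ht _
  by_cases hz : t ∈ Icc (b₁.parLo hκ h₁.seven_le_gapLo neg_seven_halves_mem) (b₁.parHi hκ h₁.seven_le_gapHi neg_five_quarters_mem)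
  · exact Or.inl (b₁.spikeFam_of_eq hcross₁ κ b₁.depthSign 1 (flipBase_eq_neckPiece h₁ h₂ hP hz))
  · right
    obtain ⟨τ, hτ, hτeq⟩ := flipBase_eq_foreignPt_of_not_mem_zone h₁ h₂ (u := u) ht hz
    have h1m : (1 : ℝ) ∈ Icc (-7 : ℝ) 7 := ⟨by norm_num, by norm_num⟩
    have hτ' : τ ∈ Icc (b₂.parLo hκ h₂.seven_le_gapLo neg_seven_mem) (b₂.parHi hκ h₂.seven_le_gapHi neg_seven_mem) :=
      ⟨(b₂.parLo_le_parLo hκ h₂.seven_le_gapLo neg_seven_mem h1m (by norm_num)).trans hτ.1,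
        hτ.2.trans (b₂.parHi_le_parHi hκ h₂.seven_le_gapHi neg_seven_mem h1m (by norm_num))⟩
    obtain ⟨hN, hchart⟩ := foreign_chart h₂ hu hτ'
    have e : flipSpikedC h₂ HC u t = flipBase h₁ h₂ u t := b₁.spikeFam_of_not_mem h₁ _ 1 (not_mem_spikeSupp_of_not_mem_zone h₁ hz)
    refine ⟨reflectLast 3 (psiN.symm (b₂.arcChart hκ h₂.seven_le_gapLo h₂.seven_le_gapHi u τ)), by rw [e, hτeq]; rfl, fun _ ↦ ?_⟩
    rw [hchart]
    exact two_le_norm_blowUp_sphereInv_arcChart_sub_cO h₂ hT b₁.depthSign hu hτ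

/-! ### The knots of the spiked flip frames are isotopic -/

/-- **The spiked flip frame is jointly `C^∞` in `(u, s)`.** [folklore] -/
theorem contDiff_flipSpikedC (hP : IsFlipPair b₁ b₂) : ContDiff ℝ ∞ (uncurry (flipSpikedC h₂ HC)) := by
  have h₁ := HC.spike
  have h1 : ContDiff ℝ ∞ (uncurry (flipBase h₁ h₂)) := contDiff_flipBase h₁ h₂ hP
  have h2 : ContDiff ℝ ∞ (fun p : ℝ × ℝ ↦ b₁.spikePiece hcross₁ κ b₁.depthSign 1 p.2) :=
    (b₁.contDiff_spikePiece_stage hcross₁ h₁.κ_pos h₁.eight_le_poleRad b₁.depthSign 1).comp contDiff_snd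
  have h3 : ContDiff ℝ ∞ (fun p : ℝ × ℝ ↦ b₁.neckPiece κ 1 p.2) :=
    (b₁.contDiff_neckPiece κ).comp ((contDiff_const (c := (1 : ℝ))).prodMk contDiff_snd)
  exact h1.add (h2.sub h3)

/-- **The knot of the spiked flip frame** (`u ∈ [0, 1]`; the frame knot of the wall frame).
[folklore] -/
def flipKnot {ε₁' r₁' : ℝ} (hf₁ : b₁.IsFlat hcross₁ ε₁' r₁') (hε₁ : ε₁' ≤ 1 / 100) (hr₁ : 5 * κ < r₁')
    (hA₁ : A₁.InNorth) (hB₁ : B₁.InSouth) (hAB₁ : Disjoint (range A₁) (range B₁)) (hB₂ : B₂.InSouth)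
    {u : ℝ} (hu : u ∈ Icc (0 : ℝ) 1) : Knot :=
  b₁.frameKnot (isWallFrame_flipSpikedC h₂ hT HC hf₁ hε₁ hr₁ hA₁ hB₁ hAB₁ hB₂ hu)

/-- **THE KNOTS OF THE SPIKED FLIP FRAMES ARE ISOTOPIC** (`u, u' ∈ [0, 1]`; a smooth family of
simple regular loops). [cite: HirschDT1976, Ch. 8 §1, Thm. 1.3] -/
theorem isIsotopic_flipKnot {ε₁' r₁' : ℝ} (hf₁ : b₁.IsFlat hcross₁ ε₁' r₁') (hε₁ : ε₁' ≤ 1 / 100) (hr₁ : 5 * κ < r₁')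
    (hA₁ : A₁.InNorth) (hB₁ : B₁.InSouth) (hAB₁ : Disjoint (range A₁) (range B₁)) (hB₂ : B₂.InSouth) :
    (flipKnot h₂ hT HC hf₁ hε₁ hr₁ hA₁ hB₁ hAB₁ hB₂ (u := 0) ⟨le_rfl, zero_le_one⟩).IsIsotopic
      (flipKnot h₂ hT HC hf₁ hε₁ hr₁ hA₁ hB₁ hAB₁ hB₂ (u := 1) ⟨zero_le_one, le_rfl⟩) := by
  have h₁ := HC.spike
  have hW := fun u (hu : u ∈ Icc (0 : ℝ) 1) ↦ isWallFrame_flipSpikedC h₂ hT HC hf₁ hε₁ hr₁ hA₁ hB₁ hAB₁ hB₂ hu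
  have hseam : ∀ u, ∀ t ∈ Ioo (b₁.alo - b₁.seamEps) (b₁.alo + b₁.seamEps), flipSpikedC h₂ HC u (t + 1) = flipSpikedC h₂ HC u t :=
    fun u ↦ seam_of_eqOn_compl (flipBase_seam h₁ h₂ u) (b₁.spikeSupp_subset κ) fun t ht ↦ b₁.spikeFam_of_not_mem h₁ _ 1 ht
  have hC : ContDiff ℝ ∞ (uncurry fun u t ↦ periodise b₁.alo (flipSpikedC h₂ HC u) t) :=
    contDiff_periodise_family (contDiff_flipSpikedC h₂ HC hP) b₁.seamEps_bounds.1 hseam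
  exact IsRegularLoop.isIsotopic_of_family_Icc hC (fun u hu ↦ (hW u hu).isRegularLoop)
    (fun u hu ↦ periodise_simple_iff.2 (hW u hu).injOn)

/-- The knot of the spiked flip frame on a circle point. [folklore] -/
theorem coe_flipKnot_circlePt {ε₁' r₁' : ℝ} (hf₁ : b₁.IsFlat hcross₁ ε₁' r₁') (hε₁ : ε₁' ≤ 1 / 100) (hr₁ : 5 * κ < r₁')
    (hA₁ : A₁.InNorth) (hB₁ : B₁.InSouth) (hAB₁ : Disjoint (range A₁) (range B₁)) (hB₂ : B₂.InSouth)
    {u : ℝ} (hu : u ∈ Icc (0 : ℝ) 1) (t : ℝ) :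
    ((flipKnot h₂ hT HC hf₁ hε₁ hr₁ hA₁ hB₁ hAB₁ hB₂ hu (circlePt t) : 𝕊 3) : 𝔼 4) = periodise b₁.alo (flipSpikedC h₂ HC u) t :=
  b₁.coe_frameKnot_circlePt _ t

/-! ### The chord at `u = 1` -/

/-- **At `u = 1`, on the chord levels `-αHi₁ s ∈ [3/2, 5/2]`, the spiked flip frame is the
reflected straight chord line of `b₂` at clock `-αHi₁ s`.** [folklore] -/
theorem flipSpikedC_one_chord {s : ℝ} (hc : s ∈ Icc (b₁.tcHi - b₁.epsHi / 8) (b₁.tcHi + b₁.epsHi / 8))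
    (hα : -b₁.alphaHi κ s ∈ Icc (3 / 2 : ℝ) (5 / 2)) :
    flipSpikedC h₂ HC 1 s = ((reflectLast 3 (psiN.symm (b₂.chordLine κ (-b₁.alphaHi κ s))) : 𝕊 3) : 𝔼 4) := by
  have h₁ := HC.spike
  have hκ := h₁.κ_pos
  have h32 : (-(3 / 2) : ℝ) ∈ Icc (-7 : ℝ) 7 := ⟨by norm_num, by norm_num⟩
  have h52 : (-(5 / 2) : ℝ) ∈ Icc (-7 : ℝ) 7 := ⟨by norm_num, by norm_num⟩
  have hs1 : b₁.parHi hκ h₁.seven_le_gapHi h32 ≤ s := (b₁.alphaHi_le_iff' hκ h₁.seven_le_gapHi h32 hc).1 (by linarith [hα.1])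
  have hs2 : s ≤ b₁.parHi hκ h₁.seven_le_gapHi h52 := (b₁.le_alphaHi_iff' hκ h₁.seven_le_gapHi h52 hc).1 (by linarith [hα.2])
  have hgt : b₁.parHi hκ h₁.seven_le_gapHi neg_five_quarters_mem < s :=
    lt_of_lt_of_le (b₁.parHi_lt_parHi hκ h₁.seven_le_gapHi h32 neg_five_quarters_mem (by norm_num)) hs1
  have hz : s ∉ Icc (b₁.parLo hκ h₁.seven_le_gapLo neg_seven_halves_mem) (b₁.parHi hκ h₁.seven_le_gapHi neg_five_quarters_mem) :=
    fun h ↦ absurd h.2 (not_le.2 hgt)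
  have e : flipSpikedC h₂ HC 1 s = flipBase h₁ h₂ 1 s := b₁.spikeFam_of_not_mem h₁ _ 1 (not_mem_spikeSupp_of_not_mem_zone h₁ hz)
  obtain ⟨-, m2⟩ := zone_marks h₁
  have hzone : s ∈ Icc (b₁.parHi hκ h₁.seven_le_gapHi neg_half_mem) (b₁.parHi hκ h₁.seven_le_gapHi neg_five_mem) :=
    ⟨(b₁.parHi_le_parHi hκ h₁.seven_le_gapHi h32 neg_half_mem (by norm_num)).trans hs1,
      hs2.trans (b₁.parHi_le_parHi hκ h₁.seven_le_gapHi neg_five_mem h52 (by norm_num))⟩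
  obtain ⟨hc₂, hlev⟩ := junctionClock_lo b₁ b₂ hκ h₁.seven_le_gapLo h₁.seven_le_gapHi h₂.seven_le_gapLo h₂.seven_le_gapHi hzone
  have hθ : theta h₁ h₂ s = jc h₁ h₂ s := theta_eq h₁ h₂ ⟨(b₁.parHi_le_parHi hκ h₁.seven_le_gapHi neg_one_mem neg_three_quarters_mem
    (by norm_num)).trans (m2.le.trans hgt.le), by
      have := (b₁.parHi_mem_core hκ h₁.seven_le_gapHi h52).2
      have := (b₁.parLo_mem_core hκ h₁.seven_le_gapLo neg_three_quarters_mem).1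
      have := b₁.core_marks; linarith⟩
  rw [e, flipBase_of_gt h₁ h₂ (m2.trans hgt), foreignPt, hθ, jc, b₂.arcChart_one_of_mem hκ h₂.seven_le_gapLo h₂.seven_le_gapHi hc₂
    (by rw [hlev]; exact hα), hlev]

end Flip

end BandData

end Literature.Topology.FourManifolds
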